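import Summits.KontsevichZagierPeriods.Zeta5Search.Certificates.VIMLevel2NKData
import Summits.KontsevichZagierPeriods.Zeta5Search.Certificates.VIMInnerModuleN
import HarnessLib

/-!
# ζ(5) search — brown9 LEVEL 2 (R-NK), key: level-1 reduction to the basis `(T(n;p,q), T(n;p+1,q))` and the assembly (cell `pub-zeta5`, certifier `cert-1`)

HONEST FRAMING: systematic search; no irrationality claim unless certified.

The termwise identity behind the ttrl2 lane's R-NK certificate (`r1c/R_NK.json`; see `Certificates/VIMLevel2NKData.lean`)
involves the 13 inner-block values `U = T(n+1;p+3,q+2)` and `T(n;p+i,q+j)` (`p = 3n−x−k`, `q = 2n−k`, `x = k₃`, `k = k₅`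
rational parameters). Here every one of them is expressed in the basis `T(n;p,q), T(n;p+1,q)` of the certified rank-2 module
(`coord_*`: `d·Y = c₀·T(n;p,q) + c₁·T(n;p+1,q)` with small REDUCED polynomial coordinates, re-derived in the seat —
`HOME/cert-1/g2/py/nk_coords2.py`) from eleven level-1 relation instances (P2 ×4, M3 ×3, M4 ×3, N1; `Certificates/VIMInnerModule(N)`),
each step being a small linear combination over OPAQUE polynomial values `peval e [n,x,k]` whose polynomial bookkeeping is
checked by the kernel (`PolyReflect.peval_eq_of_kron`, one integer evaluation each). `NK_key` then assembles: multiplying the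
cleared termwise combination `KEYPOLY` by `L` and substituting coordinates leaves `gcd₀·FIN0·T(n;p,q) + gcd₁·FIN1·T(n;p+1,q)`,
so the two kernel-checked coordinate identities `fin0/fin1` give `KEYPOLY = 0` on the region `x < 0`, `0 ≤ k ≤ n−1`, `n ≥ 2`
(where all cancelled leading coefficients are nonzero). No named facts.

Part 1: the reflected coefficients of the eleven level-1 relation instances and the instances themselves (`rel*`). (File 1 of 4.)
-/

noncomputable section

namespace Summit.KontsevichZagierPeriods.Zeta5Search.Certificates

namespace VIMInner.NK

open PolyReflect
open Lean.Grind.CommRing (Expr)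

/-- Coefficient of `T n (3 * (n : ℚ) - x - k) (2 * (n : ℚ) - k)` in instance P2(0,0): `(-2*w + x - 1)*(k - 2*w + x - 1)`. -/
def eRP2a_T00 : Expr :=
  (Expr.mul (Expr.add (Expr.add (Expr.mul (Expr.num (-2)) (Expr.var 0)) (Expr.var 1)) (Expr.num (-1))) (Expr.add (Expr.add (Expr.add (Expr.mul (Expr.num (-2)) (Expr.var 0)) (Expr.var
  1)) (Expr.var 2)) (Expr.num (-1))))

/-- Coefficient of `T n ((3 * (n : ℚ) - x - k) + 1) (2 * (n : ℚ) - k)` in instance P2(0,0): `2*k*w - 2*k*x + 2*k - 3*w**2 + 6*w*x - 6*w - 2*x**2 + 5*x - 3`. -/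
def eRP2a_T10 : Expr :=
  ((A (A (A (M (-3) 2 0 0) (M 6 1 1 0)) (A (M 2 1 0 1) (M (-6) 1 0 0))) (A (A (M (-2) 0 2 0) (M (-2) 0 1 1)) (A (M 5 0 1 0) (A (M 2 0 0 1) (M (-3) 0 0 0))))))

/-- Coefficient of `T n ((3 * (n : ℚ) - x - k) + 2) (2 * (n : ℚ) - k)` in instance P2(0,0): `(x - 1)*(k - 2*w + x - 2)`. -/
def eRP2a_T20 : Expr :=
  (Expr.mul (Expr.add (Expr.var 1) (Expr.num (-1))) (Expr.add (Expr.add (Expr.add (Expr.mul (Expr.num (-2)) (Expr.var 0)) (Expr.var 1)) (Expr.var 2)) (Expr.num (-2))))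

/-- Coefficient of `T n ((3 * (n : ℚ) - x - k) + 1) (2 * (n : ℚ) - k)` in instance P2(1,0): `(-2*w + x - 2)*(k - 2*w + x - 2)`. -/
def eRP2b_T10 : Expr :=
  (Expr.mul (Expr.add (Expr.add (Expr.mul (Expr.num (-2)) (Expr.var 0)) (Expr.var 1)) (Expr.num (-2))) (Expr.add (Expr.add (Expr.add (Expr.mul (Expr.num (-2)) (Expr.var 0)) (Expr.var
  1)) (Expr.var 2)) (Expr.num (-2))))

/-- Coefficient of `T n ((3 * (n : ℚ) - x - k) + 2) (2 * (n : ℚ) - k)` in instance P2(1,0): `2*k*w - 2*k*x + 4*k - 3*w**2 + 6*w*x - 12*w - 2*x**2 + 9*x - 10`. -/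
def eRP2b_T20 : Expr :=
  ((A (A (A (M (-3) 2 0 0) (M 6 1 1 0)) (A (M 2 1 0 1) (M (-12) 1 0 0))) (A (A (M (-2) 0 2 0) (M (-2) 0 1 1)) (A (M 9 0 1 0) (A (M 4 0 0 1) (M (-10) 0 0 0))))))

/-- Coefficient of `T n ((3 * (n : ℚ) - x - k) + 3) (2 * (n : ℚ) - k)` in instance P2(1,0): `(x - 2)*(k - 2*w + x - 3)`. -/
def eRP2b_T30 : Expr :=
  (Expr.mul (Expr.add (Expr.var 1) (Expr.num (-2))) (Expr.add (Expr.add (Expr.add (Expr.mul (Expr.num (-2)) (Expr.var 0)) (Expr.var 1)) (Expr.var 2)) (Expr.num (-3))))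

/-- Coefficient of `T n ((3 * (n : ℚ) - x - k) + 2) (2 * (n : ℚ) - k)` in instance P2(2,0): `(-2*w + x - 3)*(k - 2*w + x - 3)`. -/
def eRP2c_T20 : Expr :=
  (Expr.mul (Expr.add (Expr.add (Expr.mul (Expr.num (-2)) (Expr.var 0)) (Expr.var 1)) (Expr.num (-3))) (Expr.add (Expr.add (Expr.add (Expr.mul (Expr.num (-2)) (Expr.var 0)) (Expr.var
  1)) (Expr.var 2)) (Expr.num (-3))))

/-- Coefficient of `T n ((3 * (n : ℚ) - x - k) + 3) (2 * (n : ℚ) - k)` in instance P2(2,0): `2*k*w - 2*k*x + 6*k - 3*w**2 + 6*w*x - 18*w - 2*x**2 + 13*x - 21`. -/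
def eRP2c_T30 : Expr :=
  ((A (A (A (M (-3) 2 0 0) (M 6 1 1 0)) (A (M 2 1 0 1) (M (-18) 1 0 0))) (A (A (M (-2) 0 2 0) (M (-2) 0 1 1)) (A (M 13 0 1 0) (A (M 6 0 0 1) (M (-21) 0 0 0))))))

/-- Coefficient of `T n ((3 * (n : ℚ) - x - k) + 4) (2 * (n : ℚ) - k)` in instance P2(2,0): `(x - 3)*(k - 2*w + x - 4)`. -/
def eRP2c_T40 : Expr :=
  (Expr.mul (Expr.add (Expr.var 1) (Expr.num (-3))) (Expr.add (Expr.add (Expr.add (Expr.mul (Expr.num (-2)) (Expr.var 0)) (Expr.var 1)) (Expr.var 2)) (Expr.num (-4))))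

/-- Coefficient of `T n ((3 * (n : ℚ) - x - k) + 3) (2 * (n : ℚ) - k)` in instance M3(3,0): `(-w + x - 3)*(2*k - 3*w + x - 5)`. -/
def eRM3a_T30 : Expr :=
  (Expr.mul (Expr.add (Expr.add (Expr.neg (Expr.var 0)) (Expr.var 1)) (Expr.num (-3))) (Expr.add (Expr.add (Expr.add (Expr.mul (Expr.num (-3)) (Expr.var 0)) (Expr.var 1)) (Expr.mul
  (Expr.num 2) (Expr.var 2))) (Expr.num (-5))))

/-- Coefficient of `T n ((3 * (n : ℚ) - x - k) + 4) (2 * (n : ℚ) - k)` in instance M3(3,0): `-(x - 3)*(k - 2*w + x - 4)`. -/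
def eRM3a_T40 : Expr :=
  (Expr.mul (Expr.add (Expr.neg (Expr.var 1)) (Expr.num 3)) (Expr.add (Expr.add (Expr.add (Expr.mul (Expr.num (-2)) (Expr.var 0)) (Expr.var 1)) (Expr.var 2)) (Expr.num (-4))))

/-- Coefficient of `T n ((3 * (n : ℚ) - x - k) + 3) ((2 * (n : ℚ) - k) + 1)` in instance M3(3,0): `(-k + w + 1)*(-2*w + x - 3)`. -/
def eRM3a_T31 : Expr :=
  (Expr.mul (Expr.add (Expr.add (Expr.var 0) (Expr.neg (Expr.var 2))) (Expr.num 1)) (Expr.add (Expr.add (Expr.mul (Expr.num (-2)) (Expr.var 0)) (Expr.var 1)) (Expr.num (-3))))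

/-- Coefficient of `T n ((3 * (n : ℚ) - x - k) + 3) (2 * (n : ℚ) - k)` in instance M4(3,0): `w - x + 3`. -/
def eRM4a_T30 : Expr :=
  (Expr.add (Expr.add (Expr.var 0) (Expr.neg (Expr.var 1))) (Expr.num 3))

/-- Coefficient of `T n ((3 * (n : ℚ) - x - k) + 4) (2 * (n : ℚ) - k)` in instance M4(3,0): `x - 3`. -/
def eRM4a_T40 : Expr :=
  (Expr.add (Expr.var 1) (Expr.num (-3)))

/-- Coefficient of `T n ((3 * (n : ℚ) - x - k) + 3) ((2 * (n : ℚ) - k) + 1)` in instance M4(3,0): `-2*w + x - 3`. -/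
def eRM4a_T31 : Expr :=
  (Expr.add (Expr.add (Expr.mul (Expr.num (-2)) (Expr.var 0)) (Expr.var 1)) (Expr.num (-3)))

/-- Coefficient of `T n ((3 * (n : ℚ) - x - k) + 4) ((2 * (n : ℚ) - k) + 1)` in instance M4(3,0): `w - x + 3`. -/
def eRM4a_T41 : Expr :=
  (Expr.add (Expr.add (Expr.var 0) (Expr.neg (Expr.var 1))) (Expr.num 3))

/-- Coefficient of `T n ((3 * (n : ℚ) - x - k) + 3) ((2 * (n : ℚ) - k) + 1)` in instance M3(3,1): `(-w + x - 2)*(2*k - 3*w + x - 6)`. -/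
def eRM3b_T31 : Expr :=
  (Expr.mul (Expr.add (Expr.add (Expr.neg (Expr.var 0)) (Expr.var 1)) (Expr.num (-2))) (Expr.add (Expr.add (Expr.add (Expr.mul (Expr.num (-3)) (Expr.var 0)) (Expr.var 1)) (Expr.mul
  (Expr.num 2) (Expr.var 2))) (Expr.num (-6))))

/-- Coefficient of `T n ((3 * (n : ℚ) - x - k) + 4) ((2 * (n : ℚ) - k) + 1)` in instance M3(3,1): `-(x - 2)*(k - 2*w + x - 4)`. -/
def eRM3b_T41 : Expr :=
  (Expr.mul (Expr.add (Expr.neg (Expr.var 1)) (Expr.num 2)) (Expr.add (Expr.add (Expr.add (Expr.mul (Expr.num (-2)) (Expr.var 0)) (Expr.var 1)) (Expr.var 2)) (Expr.num (-4))))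

/-- Coefficient of `T n ((3 * (n : ℚ) - x - k) + 3) ((2 * (n : ℚ) - k) + 2)` in instance M3(3,1): `(-k + w + 2)*(-2*w + x - 2)`. -/
def eRM3b_T32 : Expr :=
  (Expr.mul (Expr.add (Expr.add (Expr.mul (Expr.num (-2)) (Expr.var 0)) (Expr.var 1)) (Expr.num (-2))) (Expr.add (Expr.add (Expr.var 0) (Expr.neg (Expr.var 2))) (Expr.num 2)))

/-- Coefficient of `T n ((3 * (n : ℚ) - x - k) + 3) ((2 * (n : ℚ) - k) + 1)` in instance M4(3,1): `w - x + 2`. -/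
def eRM4b_T31 : Expr :=
  (Expr.add (Expr.add (Expr.var 0) (Expr.neg (Expr.var 1))) (Expr.num 2))

/-- Coefficient of `T n ((3 * (n : ℚ) - x - k) + 4) ((2 * (n : ℚ) - k) + 1)` in instance M4(3,1): `x - 2`. -/
def eRM4b_T41 : Expr :=
  (Expr.add (Expr.var 1) (Expr.num (-2)))

/-- Coefficient of `T n ((3 * (n : ℚ) - x - k) + 3) ((2 * (n : ℚ) - k) + 2)` in instance M4(3,1): `-2*w + x - 2`. -/
def eRM4b_T32 : Expr :=
  (Expr.add (Expr.add (Expr.mul (Expr.num (-2)) (Expr.var 0)) (Expr.var 1)) (Expr.num (-2)))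

/-- Coefficient of `T n ((3 * (n : ℚ) - x - k) + 4) ((2 * (n : ℚ) - k) + 2)` in instance M4(3,1): `w - x + 2`. -/
def eRM4b_T42 : Expr :=
  (Expr.add (Expr.add (Expr.var 0) (Expr.neg (Expr.var 1))) (Expr.num 2))

/-- Coefficient of `T (n + 1) ((3 * (n : ℚ) - x - k) + 3) ((2 * (n : ℚ) - k) + 2)` in instance N1(3,2): `(w + 1)**2*(-k + w + 2)*(k - 2*w + x - 3)`. -/
def eRN1a_U : Expr :=
  (Expr.mul (Expr.add (Expr.var 0) (Expr.num 1)) (Expr.mul (Expr.add (Expr.var 0) (Expr.num 1)) (Expr.mul (Expr.add (Expr.add (Expr.var 0) (Expr.neg (Expr.var 2))) (Expr.num 2))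
  (Expr.add (Expr.add (Expr.add (Expr.mul (Expr.num (-2)) (Expr.var 0)) (Expr.var 1)) (Expr.var 2)) (Expr.num (-3))))))

/-- Coefficient of `T n ((3 * (n : ℚ) - x - k) + 3) ((2 * (n : ℚ) - k) + 2)` in instance N1(3,2): `-(-2*w + x - 2)*(-2*k**3 + 7*k**2*w - 4*k**2*x + 15*k**2 - 8*k*w**2 + 8*k*w*x - 34*k*w - 2*k*x**2 + 18*k*x - 36*k + 3*w**3 - 4*w**2*x + 19*w**2 + w*x**2 - 17*w*x + 40*w + 3*x**2 - 19*x + 28)`. -/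
def eRN1a_T32 : Expr :=
  (Expr.mul (Expr.add (Expr.add (Expr.mul (Expr.num 2) (Expr.var 0)) (Expr.neg (Expr.var 1))) (Expr.num 2)) ((A (A (A (A (M 3 3 0 0) (M (-4) 2 1 0)) (A (M (-8) 2 0 1) (M 19 2 0 0)))
  (A (A (M 1 1 2 0) (M 8 1 1 1)) (A (M (-17) 1 1 0) (A (M 7 1 0 2) (M (-34) 1 0 1))))) (A (A (A (M 40 1 0 0) (M (-2) 0 2 1)) (A (M 3 0 2 0) (A (M (-4) 0 1 2) (M 18
    0 1 1)))) (A
  (A (M (-19) 0 1 0) (M (-2) 0 0 3)) (A (M 15 0 0 2) (A (M (-36) 0 0 1) (M 28 0 0 0))))))))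

/-- Coefficient of `T n ((3 * (n : ℚ) - x - k) + 4) ((2 * (n : ℚ) - k) + 2)` in instance N1(3,2): `(x - 1)*(k - 2*w + x - 4)*(-2*k**2 + 4*k*w - 2*k*x + 8*k - 2*w**2 + w*x - 8*w + 3*x - 8)`. -/
def eRN1a_T42 : Expr :=
  (Expr.mul (Expr.add (Expr.var 1) (Expr.num (-1))) (Expr.mul (Expr.add (Expr.add (Expr.add (Expr.mul (Expr.num (-2)) (Expr.var 0)) (Expr.var 1)) (Expr.var 2)) (Expr.num (-4))) ((A
  (A (A (M (-2) 2 0 0) (M 1 1 1 0)) (A (M 4 1 0 1) (M (-8) 1 0 0))) (A (A (M (-2) 0 1 1) (M 3 0 1 0)) (A (M (-2) 0 0 2) (A (M 8 0 0 1) (M (-8) 0 0 0))))))))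

/-- Coefficient of `T n ((3 * (n : ℚ) - x - k) - 1) (2 * (n : ℚ) - k)` in instance P2(-1,0): `(-2*w + x)*(k - 2*w + x)`. -/
def eRP2m_Tm10 : Expr :=
  (Expr.mul (Expr.add (Expr.mul (Expr.num (-2)) (Expr.var 0)) (Expr.var 1)) (Expr.add (Expr.add (Expr.mul (Expr.num (-2)) (Expr.var 0)) (Expr.var 1)) (Expr.var 2)))

/-- Coefficient of `T n (3 * (n : ℚ) - x - k) (2 * (n : ℚ) - k)` in instance P2(-1,0): `2*k*w - 2*k*x - 3*w**2 + 6*w*x - 2*x**2 + x`. -/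
def eRP2m_T00 : Expr :=
  ((A (A (M (-3) 2 0 0) (A (M 6 1 1 0) (M 2 1 0 1))) (A (M (-2) 0 2 0) (A (M (-2) 0 1 1) (M 1 0 1 0)))))

/-- Coefficient of `T n ((3 * (n : ℚ) - x - k) + 1) (2 * (n : ℚ) - k)` in instance P2(-1,0): `x*(k - 2*w + x - 1)`. -/
def eRP2m_T10 : Expr :=
  (Expr.mul (Expr.var 1) (Expr.add (Expr.add (Expr.add (Expr.mul (Expr.num (-2)) (Expr.var 0)) (Expr.var 1)) (Expr.var 2)) (Expr.num (-1))))

/-- Coefficient of `T n ((3 * (n : ℚ) - x - k) - 1) ((2 * (n : ℚ) - k) - 1)` in instance M3(-1,-1): `(-w + x)*(2*k - 3*w + x)`. -/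
def eRM3m_Tm1m1 : Expr :=
  (Expr.mul (Expr.add (Expr.neg (Expr.var 0)) (Expr.var 1)) (Expr.add (Expr.add (Expr.mul (Expr.num (-3)) (Expr.var 0)) (Expr.var 1)) (Expr.mul (Expr.num 2) (Expr.var 2))))

/-- Coefficient of `T n (3 * (n : ℚ) - x - k) ((2 * (n : ℚ) - k) - 1)` in instance M3(-1,-1): `-x*(k - 2*w + x)`. -/
def eRM3m_T0m1 : Expr :=
  (Expr.mul (Expr.num (-1)) (Expr.mul (Expr.var 1) (Expr.add (Expr.add (Expr.mul (Expr.num (-2)) (Expr.var 0)) (Expr.var 1)) (Expr.var 2))))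

/-- Coefficient of `T n ((3 * (n : ℚ) - x - k) - 1) (2 * (n : ℚ) - k)` in instance M3(-1,-1): `(-k + w)*(-2*w + x)`. -/
def eRM3m_Tm10 : Expr :=
  (Expr.mul (Expr.add (Expr.var 0) (Expr.neg (Expr.var 2))) (Expr.add (Expr.mul (Expr.num (-2)) (Expr.var 0)) (Expr.var 1)))

/-- Coefficient of `T n ((3 * (n : ℚ) - x - k) - 1) ((2 * (n : ℚ) - k) - 1)` in instance M4(-1,-1): `w - x`. -/
def eRM4m_Tm1m1 : Expr :=
  (Expr.add (Expr.var 0) (Expr.neg (Expr.var 1)))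

/-- Coefficient of `T n (3 * (n : ℚ) - x - k) ((2 * (n : ℚ) - k) - 1)` in instance M4(-1,-1): `x`. -/
def eRM4m_T0m1 : Expr :=
  (Expr.var 1)

/-- Coefficient of `T n ((3 * (n : ℚ) - x - k) - 1) (2 * (n : ℚ) - k)` in instance M4(-1,-1): `-2*w + x`. -/
def eRM4m_Tm10 : Expr :=
  (Expr.add (Expr.mul (Expr.num (-2)) (Expr.var 0)) (Expr.var 1))

/-- Coefficient of `T n (3 * (n : ℚ) - x - k) (2 * (n : ℚ) - k)` in instance M4(-1,-1): `w - x`. -/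
def eRM4m_T00 : Expr :=
  (Expr.add (Expr.var 0) (Expr.neg (Expr.var 1)))

/-- Level-1 instance P2(0,0) with reflected coefficients. -/
theorem relP2a (n : ℕ) (hn : 2 ≤ n) (x k : ℚ) :
    peval eRP2a_T00 [(n : ℚ), x, k] * T n (3 * (n : ℚ) - x - k) (2 * (n : ℚ) - k) + peval eRP2a_T10 [(n : ℚ), x, k] * T n ((3 * (n : ℚ) - x - k) + 1) (2 * (n : ℚ) -
      k) + peval eRP2a_T20 [(n : ℚ), x, k] * T n ((3 * (n : ℚ) - x - k) + 2) (2 * (n : ℚ) - k) = 0 := by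
  have r := T_rel_P2 n hn (3 * (n : ℚ) - x - k) (2 * (n : ℚ) - k)
  have d0 : pvar [(n : ℚ), x, k] 0 = (n : ℚ) := rfl
  have d1 : pvar [(n : ℚ), x, k] 1 = x := rfl
  have d2 : pvar [(n : ℚ), x, k] 2 = k := rfl
  simp only [eRP2a_T00, eRP2a_T10, eRP2a_T20, A, peval_add, peval_mul, peval_num, peval_M, peval_var, d0, d1, d2]
  push_cast at r ⊢
  linear_combination r

/-- Level-1 instance P2(1,0) with reflected coefficients. -/
theorem relP2b (n : ℕ) (hn : 2 ≤ n) (x k : ℚ) :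
    peval eRP2b_T10 [(n : ℚ), x, k] * T n ((3 * (n : ℚ) - x - k) + 1) (2 * (n : ℚ) - k) + peval eRP2b_T20 [(n : ℚ), x, k] * T n ((3 * (n : ℚ) - x - k) + 2) (2 * (n
      : ℚ) - k) + peval eRP2b_T30 [(n : ℚ), x, k] * T n ((3 * (n : ℚ) - x - k) + 3) (2 * (n : ℚ) - k) = 0 := by
  have r := T_rel_P2 n hn ((3 * (n : ℚ) - x - k) + 1) (2 * (n : ℚ) - k)
  rw [show (3 * (n : ℚ) - x - k) + 1 + 1 = (3 * (n : ℚ) - x - k) + 2 by ring, show (3 * (n : ℚ) - x - k) + 1 + 2 = (3 * (n : ℚ) - x - k) + 3 by ring] at r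
  have d0 : pvar [(n : ℚ), x, k] 0 = (n : ℚ) := rfl
  have d1 : pvar [(n : ℚ), x, k] 1 = x := rfl
  have d2 : pvar [(n : ℚ), x, k] 2 = k := rfl
  simp only [eRP2b_T10, eRP2b_T20, eRP2b_T30, A, peval_add, peval_mul, peval_num, peval_M, peval_var, d0, d1, d2]
  push_cast at r ⊢
  linear_combination r

/-- Level-1 instance P2(2,0) with reflected coefficients. -/
theorem relP2c (n : ℕ) (hn : 2 ≤ n) (x k : ℚ) :
    peval eRP2c_T20 [(n : ℚ), x, k] * T n ((3 * (n : ℚ) - x - k) + 2) (2 * (n : ℚ) - k) + peval eRP2c_T30 [(n : ℚ), x, k] * T n ((3 * (n : ℚ) - x - k) + 3) (2 * (n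
      : ℚ) - k) + peval eRP2c_T40 [(n : ℚ), x, k] * T n ((3 * (n : ℚ) - x - k) + 4) (2 * (n : ℚ) - k) = 0 := by
  have r := T_rel_P2 n hn ((3 * (n : ℚ) - x - k) + 2) (2 * (n : ℚ) - k)
  rw [show (3 * (n : ℚ) - x - k) + 2 + 1 = (3 * (n : ℚ) - x - k) + 3 by ring, show (3 * (n : ℚ) - x - k) + 2 + 2 = (3 * (n : ℚ) - x - k) + 4 by ring] at r
  have d0 : pvar [(n : ℚ), x, k] 0 = (n : ℚ) := rfl
  have d1 : pvar [(n : ℚ), x, k] 1 = x := rfl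
  have d2 : pvar [(n : ℚ), x, k] 2 = k := rfl
  simp only [eRP2c_T20, eRP2c_T30, eRP2c_T40, A, peval_add, peval_mul, peval_num, peval_M, peval_var, d0, d1, d2]
  push_cast at r ⊢
  linear_combination r

/-- Level-1 instance M3(3,0) with reflected coefficients. -/
theorem relM3a (n : ℕ) (hn : 2 ≤ n) (x k : ℚ) :
    peval eRM3a_T30 [(n : ℚ), x, k] * T n ((3 * (n : ℚ) - x - k) + 3) (2 * (n : ℚ) - k) + peval eRM3a_T40 [(n : ℚ), x, k] * T n ((3 * (n : ℚ) - x - k) + 4) (2 * (n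
      : ℚ) - k) + peval eRM3a_T31 [(n : ℚ), x, k] * T n ((3 * (n : ℚ) - x - k) + 3) ((2 * (n : ℚ) - k) + 1) = 0 := by
  have hn1 : 1 ≤ n := by omega
  have r := T_rel_M3 n hn1 ((3 * (n : ℚ) - x - k) + 3) (2 * (n : ℚ) - k)
  rw [show (3 * (n : ℚ) - x - k) + 3 + 1 = (3 * (n : ℚ) - x - k) + 4 by ring] at r
  have d0 : pvar [(n : ℚ), x, k] 0 = (n : ℚ) := rfl
  have d1 : pvar [(n : ℚ), x, k] 1 = x := rfl
  have d2 : pvar [(n : ℚ), x, k] 2 = k := rfl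
  simp only [eRM3a_T30, eRM3a_T40, eRM3a_T31, peval_add, peval_neg, peval_mul, peval_num, peval_var, d0, d1, d2]
  push_cast at r ⊢
  linear_combination r

/-- Level-1 instance M4(3,0) with reflected coefficients. -/
theorem relM4a (n : ℕ) (hn : 2 ≤ n) (x k : ℚ) :
    peval eRM4a_T30 [(n : ℚ), x, k] * T n ((3 * (n : ℚ) - x - k) + 3) (2 * (n : ℚ) - k) + peval eRM4a_T40 [(n : ℚ), x, k] * T n ((3 * (n : ℚ) - x - k) + 4) (2 * (n
      : ℚ) - k) + peval eRM4a_T31 [(n : ℚ), x, k] * T n ((3 * (n : ℚ) - x - k) + 3) ((2 * (n : ℚ) - k) + 1) + peval eRM4a_T41 [(n : ℚ), x, k] * T n ((3 * (n :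
      ℚ) - x - k) + 4) ((2 * (n : ℚ) - k) + 1) = 0 := by
  have hn1 : 1 ≤ n := by omega
  have r := T_rel_M4 n hn1 ((3 * (n : ℚ) - x - k) + 3) (2 * (n : ℚ) - k)
  rw [show (3 * (n : ℚ) - x - k) + 3 + 1 = (3 * (n : ℚ) - x - k) + 4 by ring] at r
  have d0 : pvar [(n : ℚ), x, k] 0 = (n : ℚ) := rfl
  have d1 : pvar [(n : ℚ), x, k] 1 = x := rfl
  simp only [eRM4a_T30, eRM4a_T40, eRM4a_T31, eRM4a_T41, peval_add, peval_neg, peval_mul, peval_num, peval_var, d0, d1]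
  push_cast at r ⊢
  linear_combination r

/-- Level-1 instance M3(3,1) with reflected coefficients. -/
theorem relM3b (n : ℕ) (hn : 2 ≤ n) (x k : ℚ) :
    peval eRM3b_T31 [(n : ℚ), x, k] * T n ((3 * (n : ℚ) - x - k) + 3) ((2 * (n : ℚ) - k) + 1) + peval eRM3b_T41 [(n : ℚ), x, k] * T n ((3 * (n : ℚ) - x - k) + 4)
      ((2 * (n : ℚ) - k) + 1) + peval eRM3b_T32 [(n : ℚ), x, k] * T n ((3 * (n : ℚ) - x - k) + 3) ((2 * (n : ℚ) - k) + 2) = 0 := by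
  have hn1 : 1 ≤ n := by omega
  have r := T_rel_M3 n hn1 ((3 * (n : ℚ) - x - k) + 3) ((2 * (n : ℚ) - k) + 1)
  rw [show (3 * (n : ℚ) - x - k) + 3 + 1 = (3 * (n : ℚ) - x - k) + 4 by ring, show (2 * (n : ℚ) - k) + 1 + 1 = (2 * (n : ℚ) - k) + 2 by ring] at r
  have d0 : pvar [(n : ℚ), x, k] 0 = (n : ℚ) := rfl
  have d1 : pvar [(n : ℚ), x, k] 1 = x := rfl
  have d2 : pvar [(n : ℚ), x, k] 2 = k := rfl
  simp only [eRM3b_T31, eRM3b_T41, eRM3b_T32, peval_add, peval_neg, peval_mul, peval_num, peval_var, d0, d1, d2]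
  push_cast at r ⊢
  linear_combination r

/-- Level-1 instance M4(3,1) with reflected coefficients. -/
theorem relM4b (n : ℕ) (hn : 2 ≤ n) (x k : ℚ) :
    peval eRM4b_T31 [(n : ℚ), x, k] * T n ((3 * (n : ℚ) - x - k) + 3) ((2 * (n : ℚ) - k) + 1) + peval eRM4b_T41 [(n : ℚ), x, k] * T n ((3 * (n : ℚ) - x - k) + 4)
      ((2 * (n : ℚ) - k) + 1) + peval eRM4b_T32 [(n : ℚ), x, k] * T n ((3 * (n : ℚ) - x - k) + 3) ((2 * (n : ℚ) - k) + 2) + peval eRM4b_T42 [(n : ℚ), x, k] * T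
      n ((3 * (n : ℚ) - x - k) + 4) ((2 * (n : ℚ) - k) + 2) = 0 := by
  have hn1 : 1 ≤ n := by omega
  have r := T_rel_M4 n hn1 ((3 * (n : ℚ) - x - k) + 3) ((2 * (n : ℚ) - k) + 1)
  rw [show (3 * (n : ℚ) - x - k) + 3 + 1 = (3 * (n : ℚ) - x - k) + 4 by ring, show (2 * (n : ℚ) - k) + 1 + 1 = (2 * (n : ℚ) - k) + 2 by ring] at r
  have d0 : pvar [(n : ℚ), x, k] 0 = (n : ℚ) := rfl
  have d1 : pvar [(n : ℚ), x, k] 1 = x := rfl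
  simp only [eRM4b_T31, eRM4b_T41, eRM4b_T32, eRM4b_T42, peval_add, peval_neg, peval_mul, peval_num, peval_var, d0, d1]
  push_cast at r ⊢
  linear_combination r

/-- Level-1 instance N1(3,2) with reflected coefficients. -/
theorem relN1a (n : ℕ) (hn : 2 ≤ n) (x k : ℚ) :
    peval eRN1a_U [(n : ℚ), x, k] * T (n + 1) ((3 * (n : ℚ) - x - k) + 3) ((2 * (n : ℚ) - k) + 2) + peval eRN1a_T32 [(n : ℚ), x, k] * T n ((3 * (n : ℚ) - x - k) +
      3) ((2 * (n : ℚ) - k) + 2) + peval eRN1a_T42 [(n : ℚ), x, k] * T n ((3 * (n : ℚ) - x - k) + 4) ((2 * (n : ℚ) - k) + 2) = 0 := by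
  have hn1 : 1 ≤ n := by omega
  have r := T_rel_N1 n hn1 ((3 * (n : ℚ) - x - k) + 3) ((2 * (n : ℚ) - k) + 2)
  simp only [cN1, cN0, cNp] at r
  rw [show (3 * (n : ℚ) - x - k) + 3 + 1 = (3 * (n : ℚ) - x - k) + 4 by ring] at r
  have d0 : pvar [(n : ℚ), x, k] 0 = (n : ℚ) := rfl
  have d1 : pvar [(n : ℚ), x, k] 1 = x := rfl
  have d2 : pvar [(n : ℚ), x, k] 2 = k := rfl
  simp only [eRN1a_U, eRN1a_T32, eRN1a_T42, A, peval_add, peval_neg, peval_mul, peval_num, peval_M, peval_var, d0, d1, d2]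
  push_cast at r ⊢
  linear_combination r

/-- Level-1 instance P2(-1,0) with reflected coefficients. -/
theorem relP2m (n : ℕ) (hn : 2 ≤ n) (x k : ℚ) :
    peval eRP2m_Tm10 [(n : ℚ), x, k] * T n ((3 * (n : ℚ) - x - k) - 1) (2 * (n : ℚ) - k) + peval eRP2m_T00 [(n : ℚ), x, k] * T n (3 * (n : ℚ) - x - k) (2 * (n : ℚ)
      - k) + peval eRP2m_T10 [(n : ℚ), x, k] * T n ((3 * (n : ℚ) - x - k) + 1) (2 * (n : ℚ) - k) = 0 := by
  have r := T_rel_P2 n hn ((3 * (n : ℚ) - x - k) - 1) (2 * (n : ℚ) - k)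
  rw [show (3 * (n : ℚ) - x - k) - 1 + 1 = (3 * (n : ℚ) - x - k) by ring, show (3 * (n : ℚ) - x - k) - 1 + 2 = (3 * (n : ℚ) - x - k) + 1 by ring] at r
  have d0 : pvar [(n : ℚ), x, k] 0 = (n : ℚ) := rfl
  have d1 : pvar [(n : ℚ), x, k] 1 = x := rfl
  have d2 : pvar [(n : ℚ), x, k] 2 = k := rfl
  simp only [eRP2m_Tm10, eRP2m_T00, eRP2m_T10, A, peval_add, peval_mul, peval_num, peval_M, peval_var, d0, d1, d2]
  push_cast at r ⊢
  linear_combination r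

/-- Level-1 instance M3(-1,-1) with reflected coefficients. -/
theorem relM3m (n : ℕ) (hn : 2 ≤ n) (x k : ℚ) :
    peval eRM3m_Tm1m1 [(n : ℚ), x, k] * T n ((3 * (n : ℚ) - x - k) - 1) ((2 * (n : ℚ) - k) - 1) + peval eRM3m_T0m1 [(n : ℚ), x, k] * T n (3 * (n : ℚ) - x - k) ((2 *
      (n : ℚ) - k) - 1) + peval eRM3m_Tm10 [(n : ℚ), x, k] * T n ((3 * (n : ℚ) - x - k) - 1) (2 * (n : ℚ) - k) = 0 := by
  have hn1 : 1 ≤ n := by omega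
  have r := T_rel_M3 n hn1 ((3 * (n : ℚ) - x - k) - 1) ((2 * (n : ℚ) - k) - 1)
  rw [show (3 * (n : ℚ) - x - k) - 1 + 1 = (3 * (n : ℚ) - x - k) by ring, show (2 * (n : ℚ) - k) - 1 + 1 = (2 * (n : ℚ) - k) by ring] at r
  have d0 : pvar [(n : ℚ), x, k] 0 = (n : ℚ) := rfl
  have d1 : pvar [(n : ℚ), x, k] 1 = x := rfl
  have d2 : pvar [(n : ℚ), x, k] 2 = k := rfl
  simp only [eRM3m_Tm1m1, eRM3m_T0m1, eRM3m_Tm10, peval_add, peval_neg, peval_mul, peval_num, peval_var, d0, d1, d2]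
  push_cast at r ⊢
  linear_combination r

/-- Level-1 instance M4(-1,-1) with reflected coefficients. -/
theorem relM4m (n : ℕ) (hn : 2 ≤ n) (x k : ℚ) :
    peval eRM4m_Tm1m1 [(n : ℚ), x, k] * T n ((3 * (n : ℚ) - x - k) - 1) ((2 * (n : ℚ) - k) - 1) + peval eRM4m_T0m1 [(n : ℚ), x, k] * T n (3 * (n : ℚ) - x - k) ((2 *
      (n : ℚ) - k) - 1) + peval eRM4m_Tm10 [(n : ℚ), x, k] * T n ((3 * (n : ℚ) - x - k) - 1) (2 * (n : ℚ) - k) + peval eRM4m_T00 [(n : ℚ), x, k] * T n (3 * (n :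
      ℚ) - x - k) (2 * (n : ℚ) - k) = 0 := by
  have hn1 : 1 ≤ n := by omega
  have r := T_rel_M4 n hn1 ((3 * (n : ℚ) - x - k) - 1) ((2 * (n : ℚ) - k) - 1)
  rw [show (3 * (n : ℚ) - x - k) - 1 + 1 = (3 * (n : ℚ) - x - k) by ring, show (2 * (n : ℚ) - k) - 1 + 1 = (2 * (n : ℚ) - k) by ring] at r
  have d0 : pvar [(n : ℚ), x, k] 0 = (n : ℚ) := rfl
  have d1 : pvar [(n : ℚ), x, k] 1 = x := rfl
  simp only [eRM4m_Tm1m1, eRM4m_T0m1, eRM4m_Tm10, eRM4m_T00, peval_add, peval_neg, peval_mul, peval_num, peval_var, d0, d1]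
  push_cast at r ⊢
  linear_combination r

/-! ### Coordinates of every atom in the basis `(T(n;p,q), T(n;p+1,q))` -/

/-- Denominator `d` of the coordinates of `T n ((3 * (n : ℚ) - x - k) + 2) (2 * (n : ℚ) - k)`: `(x - 1)*(k - 2*w + x - 2)`. -/
def eD_T20 : Expr :=
  (Expr.mul (Expr.add (Expr.var 1) (Expr.num (-1))) (Expr.add (Expr.add (Expr.add (Expr.mul (Expr.num (-2)) (Expr.var 0)) (Expr.var 1)) (Expr.var 2)) (Expr.num (-2))))

/-- Coordinate `c₀` of `T n ((3 * (n : ℚ) - x - k) + 2) (2 * (n : ℚ) - k)`. -/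
def eC0_T20 : Expr :=
  (Expr.mul (Expr.add (Expr.add (Expr.mul (Expr.num 2) (Expr.var 0)) (Expr.neg (Expr.var 1))) (Expr.num 1)) (Expr.add (Expr.add (Expr.add (Expr.mul (Expr.num (-2)) (Expr.var 0))
  (Expr.var 1)) (Expr.var 2)) (Expr.num (-1))))

/-- Coordinate `c₁` of `T n ((3 * (n : ℚ) - x - k) + 2) (2 * (n : ℚ) - k)`. -/
def eC1_T20 : Expr :=
  ((A (A (A (M 3 2 0 0) (M (-6) 1 1 0)) (A (M (-2) 1 0 1) (M 6 1 0 0))) (A (A (M 2 0 2 0) (M 2 0 1 1)) (A (M (-5) 0 1 0) (A (M (-2) 0 0 1) (M 3 0 0 0))))))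

/-- Denominator `d` of the coordinates of `T n ((3 * (n : ℚ) - x - k) + 3) (2 * (n : ℚ) - k)`: `(x - 2)*(x - 1)*(k - 2*w + x - 3)*(k - 2*w + x - 2)`. -/
def eD_T30 : Expr :=
  (Expr.mul (Expr.add (Expr.var 1) (Expr.num (-1))) (Expr.mul (Expr.add (Expr.var 1) (Expr.num (-2))) (Expr.mul (Expr.add (Expr.add (Expr.add (Expr.mul (Expr.num (-2)) (Expr.var 0))
  (Expr.var 1)) (Expr.var 2)) (Expr.num (-3))) (Expr.add (Expr.add (Expr.add (Expr.mul (Expr.num (-2)) (Expr.var 0)) (Expr.var 1)) (Expr.var 2)) (Expr.num (-2))))))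

/-- Coordinate `c₀` of `T n ((3 * (n : ℚ) - x - k) + 3) (2 * (n : ℚ) - k)`. -/
def eC0_T30 : Expr :=
  (Expr.mul (Expr.add (Expr.add (Expr.mul (Expr.num 2) (Expr.var 0)) (Expr.neg (Expr.var 1))) (Expr.num 1)) (Expr.mul (Expr.add (Expr.add (Expr.add (Expr.mul (Expr.num (-2))
  (Expr.var 0)) (Expr.var 1)) (Expr.var 2)) (Expr.num (-1))) ((A (A (A (M 3 2 0 0) (M (-6) 1 1 0)) (A (M (-2) 1 0 1) (M 12 1 0 0))) (A (A (M 2 0 2 0) (M 2 0 1 1)) (A (M (-9) 0 1 0)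
  (A (M (-4) 0 0 1) (M 10 0 0 0))))))))

/-- Coordinate `c₁` of `T n ((3 * (n : ℚ) - x - k) + 3) (2 * (n : ℚ) - k)`. -/
def eC1_T30 : Expr :=
  ((A (A (A (A (M 9 4 0 0) (A (M (-28) 3 1 0) (M (-12) 3 0 1))) (A (A (M 46 3 0 0) (M 36 2 2 0)) (A (M 28 2 1 1) (M (-114) 2 1 0)))) (A (A (A (M 4 2 0 2) (M (-46) 2 0 1)) (A (M 87 2
  0 0) (M (-18) 1 3 0))) (A (A (M (-24) 1 2 1) (M 90 1 2
    0)) (A (M (-6) 1 1 2) (M 76 1 1 1))))) (A (A (A (A (M (-144) 1 1 0) (M 10 1 0 2)) (A (M (-58) 1 0 1) (M 72 1 0 0))) (A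
  (A (M 3 0 4 0) (M 6 0 3 1)) (A (M (-21) 0 3 0) (M 3 0 2 2)))) (A (A (A (M (-30) 0 2 1) (M 53 0 2 0)) (A (M (-9)
    0 1 2) (M 48 0 1 1))) (A (A (M (-57) 0 1 0) (M 6 0 0 2)) (A (M
  (-24) 0 0 1) (M 22 0 0 0)))))))

/-- Denominator `d` of the coordinates of `T n ((3 * (n : ℚ) - x - k) + 4) (2 * (n : ℚ) - k)`: `(x - 3)*(x - 2)*(x - 1)*(k - 2*w + x - 4)*(k - 2*w + x - 3)*(k - 2*w + x - 2)`. -/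
def eD_T40 : Expr :=
  (Expr.mul (Expr.add (Expr.var 1) (Expr.num (-1))) (Expr.mul (Expr.add (Expr.var 1) (Expr.num (-3))) (Expr.mul (Expr.add (Expr.var 1) (Expr.num (-2))) (Expr.mul (Expr.add (Expr.add
  (Expr.add (Expr.mul (Expr.num (-2)) (Expr.var 0)) (Expr.var 1)) (Expr.var 2)) (Expr.num (-4))) (Expr.mul (Expr.add (Expr.add (Expr.add (Expr.mul (Expr.num (-2)) (Expr.var 0))
  (Expr.var 1)) (Expr.var 2)) (Expr.num (-3))) (Expr.add (Expr.add (Expr.add (Expr.mul (Expr.num (-2)) (Expr.var 0)) (Expr.var 1)) (Expr.var 2)) (Expr.num (-2))))))))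

end VIMInner.NK

end Summit.KontsevichZagierPeriods.Zeta5Search.Certificates
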